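import Summits.QuantumFields.YangMills.Theorems.CurvatureSandwichBound.Negative.TiedConstField
import Summits.QuantumFields.YangMills.Theorems.CurvatureSandwichBound.Negative.SupNormOnlyFalse
import Literature.MathematicalPhysics.QuantumLattice.GaugeGroupsProofs

/-!
# `CurvatureSandwichBound` (Σ) — negative-side support VI: the crux-shaped sup-norm-only strengthening of Σ is
FALSE unconditionally

Support file for crux `stmt-QuantumFields-18372` (refuter, cdisprove), extracted from the work file
`Cruxes/CurvatureSandwichBound/Disproof.lean`.  Tree objects only; nothing is posited.

* `CurvatureSandwichBoundSup` — Σ's hypotheses verbatim (`W1`, eight frames, cone, soft kernel), first row with the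
  `L¹`-mass `Mh` of the transverse profile dropped from the constant (`C·Mg·Mh'·(u^{-μ}+v^{-μ})`).
* `sandwichBound_of_sup` — for `C ≥ 0` the strengthened row implies Σ's row (monotonicity).
* `not_curvatureSandwichBoundSup` — FALSE: witness `G = SU(2)` (compact simple), the fundamental representation,
  `constScheme r 1` (`β ≡ 0`, `c ≡ 1`), the constant field `1` (all hypotheses: landed `hypotheses_constField`), and
  the landed `not_exists_sandwichBoundSup_constField_one`.  Planners: never state Σ with `Mh'` alone — the `L¹`
  mass is forced already by the c-number limits of lattice Yang–Mills at infinite coupling.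
-/

noncomputable section

namespace Summit.QuantumFields.YangMills.Theorems.CurvatureSandwichBound.Negative

open scoped BigOperators SchwartzMap
open MeasureTheory Filter Topology Complex
open Literature.MathematicalPhysics.QuantumLattice Literature.MathematicalPhysics.AQFT
  Literature.MathematicalPhysics.QuantumFieldTheory
open Summit.QuantumFields.YangMills.Theorems.NPointIsotropy.Negative (E4)
open Summit.QuantumFields.YangMills.Theorems.CurvatureBoostCovariance.Negative (EightFrameRP PlanarCone W1)
open Summit.QuantumFields.YangMills.Theorems.SoftKernelBoostCovariance.Negative (SoftKernel)
open Summit.QuantumFields.YangMills.Theorems.DiagonalMirrorRPR.Negative (constField)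

/-! ## The crux-shaped sup-norm-only strengthening is false -/

/-- **Σ with the `L¹`-mass `Mh` of `hh` DROPPED from the constant** (first row only; same hypotheses as the crux). -/
def CurvatureSandwichBoundSup : Prop :=
  ∀ (G : Type) [Group G] [TopologicalSpace G] [IsTopologicalGroup G] [CompactSpace G]
    [MeasurableSpace G] [BorelSpace G], IsCompactSimpleLieGroup G →
    ∀ (r : LatticeRep G) (sch : SpeciesScheme (YMSpecies G)) (S₁ : SchwingerFamily E4),
      W1 r sch S₁ → EightFrameRP S₁ → PlanarCone S₁ → SoftKernel S₁ →
        ∀ h : OSReconstructionNoE1 S₁.toLabelled, ∃ μ C : ℝ, μ < 4 ∧ SandwichBoundSup S₁ h μ C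

/-- The crux implies nothing about `CurvatureSandwichBoundSup`; conversely the strengthening implies the first row
of the crux only when `C ≥ 0` is granted — recorded as the obvious monotonicity for nonnegative constants. -/
theorem sandwichBound_of_sup {S₁ : SchwingerFamily E4} {h : OSReconstructionNoE1 S₁.toLabelled} {μ C : ℝ}
    (hC : 0 ≤ C) (hS : SandwichBoundSup S₁ h μ C) : SandwichBound S₁ h μ C := by
  intro u v hu hv hu1 hv1 f₁ g hh Mg Mh Mh' hf₁ hg hgi hgM hhi hhM hhM' n W hW hFW
  have hMg : 0 ≤ Mg := (integral_nonneg fun _ => norm_nonneg _).trans hgM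
  have hMh : 0 ≤ Mh := (integral_nonneg fun _ => norm_nonneg _).trans hhM
  have huv : 0 ≤ u ^ (-μ) + v ^ (-μ) := add_nonneg (Real.rpow_nonneg hu.le _) (Real.rpow_nonneg hv.le _)
  calc _ ≤ C * Mg * Mh' * (u ^ (-μ) + v ^ (-μ)) * ‖h.fieldVec n (fun _ => ()) W hW‖ :=
        hS u v hu hv hu1 hv1 f₁ g hh Mg Mh Mh' hf₁ hg hgi hgM hhi hhM hhM' n W hW hFW
    _ ≤ C * Mg * (Mh + Mh') * (u ^ (-μ) + v ^ (-μ)) * ‖h.fieldVec n (fun _ => ()) W hW‖ := by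
        gcongr
        linarith

/-- **Theorem (the `L¹`-mass is load-bearing: the sup-norm-only strengthening of Σ is false).**  Witness:
`G = SU(2)` (compact simple), the fundamental representation, `constScheme r 1` (`β ≡ 0`, `c ≡ 1`), the constant
field `1` (all hypotheses: `hypotheses_constField`), and `not_exists_sandwichBoundSup_constField_one`. [folklore] -/
theorem not_curvatureSandwichBoundSup : ¬ CurvatureSandwichBoundSup := by
  intro hSup
  have hG : IsCompactSimpleLieGroup (Matrix.specialUnitaryGroup (Fin 2) ℂ) :=
    isCompactSimpleLieGroup_specialUnitaryGroup isSimpleCompactGroup_specialUnitaryGroup_holds le_rfl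
  letI : MeasurableSpace (Matrix.specialUnitaryGroup (Fin 2) ℂ) := borel _
  haveI : BorelSpace (Matrix.specialUnitaryGroup (Fin 2) ℂ) := ⟨rfl⟩
  let r : LatticeRep (Matrix.specialUnitaryGroup (Fin 2) ℂ) :=
    ⟨2, fundamentalRep (Fin 2), continuous_fundamentalRep _, fundamentalRep_injective _,
      fundamentalRep_mem_unitaryGroup⟩
  obtain ⟨hW, h8, hC, hK, -⟩ := hypotheses_constField r 1
  exact not_exists_sandwichBoundSup_constField_one
    (hSup (Matrix.specialUnitaryGroup (Fin 2) ℂ) hG r (constScheme r 1) (constField 1) hW h8 hC hK _)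

end Summit.QuantumFields.YangMills.Theorems.CurvatureSandwichBound.Negative

end
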